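import Summits.QuantumFields.YangMills.Theorems.ColdStartUniversalityShenZhuZhuLargeNFactorisationSUN
import Summits.QuantumFields.YangMills.Theorems.ColdStartUniversalityShenZhuZhuGradientFormSUN
import Literature.MathematicalPhysics.QuantumFieldTheory.Z2WilsonLoopGKS
import HarnessLib

/-!
# Shen–Zhu–Zhu's Corollary 1.5 (1.12) for `SU(N)` WITH THE PRINTED CONSTANT `4/K_𝒮`, every `N ≥ 1`, every `d ≥ 2`:
# the `SU(N)` conjunct of the named fact `shenZhuZhu_largeN_variance d N`, and the fact reduced to its `SO(N)` half

Seat `ym-line-csu-p1` (g41), route `ColdStartUniversality` of `Summits/QuantumFields/YangMills`, helper file G39 (strong coupling;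
`--supports stmt-QuantumFields-24809`).  G25/G26 (`szzLoopVarianceBound_sun`, g39) proved Shen–Zhu–Zhu's loop-variance shape
`SZZLoopVarianceBound (fundamentalRep (Fin N)) d (Nβ) C` for every `C ≥ 8/K`, `K = N/2 − 4dN|β|`, from `Var(Re W_ℓ/N), Var(Im W_ℓ/N) ≤ Σ_e mult_ℓ(e)²/(NK)`
and the crude count `Σ_e mult_ℓ(e)² ≤ n²`.  The Literature's named fact (`ShenZhuZhuPoincareApplications`) carries SZZ's PRINTED constant `4/K_𝒮`,
`K_𝒮 = N/2 − 8N(d−1)|β|` (`≤ K` for `d ≥ 2`).  The missing factor `2` is pure lattice combinatorics, supplied here: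

* §1 `two_mul_count_le_length_of_head_ne`, `two_mul_count_le_length_of_isChain_cyclic` — in a list with no two CYCLICALLY adjacent equal entries,
  every value occurs at most `length/2` times.
* §2 `dartStep_fst_ne_of_dartAdj` (with the Literature's `Dart.edge_eq_of_dartStep`) — two consecutive darts of a lattice walk that do not backtrack lie over DIFFERENT links; hence
  ★ `two_mul_dartMult_le_length` — in a loop in SZZ's sense (closed, non-backtracking read cyclically) every link has multiplicity `≤ n/2`, and
  ★ `sum_dartMult_sq_le_half_length_sq` — **`Σ_e mult_ℓ(e)² ≤ n²/2`** (sharp: the plaquette run around `n/4` times).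
* §3 ★★★ `szzLoopVarianceBound_sun_sharp` — `SZZLoopVarianceBound (fundamentalRep (Fin N)) d (Nβ) C` for every `C ≥ 4/K`, `K = N/2 − 4dN|β| > 0`, every
  `N ≥ 1`, every `d` (`Var(Re W_ℓ/N) + Var(Im W_ℓ/N) ≤ n²/(NK) ≤ (4/K)·n(n−3)/N` as `n ≥ 4`);
  ★★★ `szzLoopVarianceBound_sun_printed` — the PRINTED statement: `d ≥ 2`, `N ≥ 1`, `|β| < 1/(16(d−1))` ⇒
  `SZZLoopVarianceBound (fundamentalRep (Fin N)) d (Nβ) (4 / szzBakryEmeryConstSU N d β)`, i.e. SZZ (1.12) `Var(W_ℓ/N) ≤ 4n(n−3)/(K_𝒮 N)` for `SU(N)` under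
  every infinite-volume limit point;
  ★★★ `shenZhuZhu_largeN_variance_SU` — the FIRST CONJUNCT of the named fact `shenZhuZhu_largeN_variance d N` verbatim, for EVERY `d`, `N`;
  ★★ `shenZhuZhu_largeN_variance_iff_SO` — for every `d`, `N` the named fact is EQUIVALENT to its `SO(N)` conjunct (the remaining Literature debt is
  exactly the `SO(N)` Bakry–Émery input, vacuous for `N ≤ 2`: G25 `shenZhuZhu_largeN_variance_of_le_two`).

THEOREMS ONLY, no definition, no sorry.  HONEST FRAMING: STRONG coupling (`|β| < 1/(8d)` resp. SZZ's `1/(16(d−1))`), lattice, `SU(N)`; the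
`SO(N)` half of the named fact (N ≥ 3) is NOT proved; nothing at weak coupling / in the continuum, nothing `K`-uniform along the route's scaling
(`UniformColdStartMixing`, 24809, ASIDE, not restated); no crux, rung or summit statement is proved; the Yang–Mills mass gap is NOT proved.

References: H. Shen, R. Zhu, X. Zhu, CMP 400 (2023) 805–851 = arXiv:2204.12737, Cor. 1.5 (1.12), §4.2 (4.15)–(4.18) [ShenZhuZhu2022].
-/

set_option autoImplicit false

noncomputable section

namespace Summit.QuantumFields.YangMills.Theorems.ColdStartUniversality

open MeasureTheory ProbabilityTheory Finset Filter Set Function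
open scoped BigOperators NNReal ENNReal Topology Matrix
open SimpleGraph
open Literature.Probability.LatticeModels (Site zdGraph)
open Literature.MathematicalPhysics.QuantumFieldTheory
open Literature.MathematicalPhysics.QuantumLattice (fundamentalRep continuous_fundamentalRep fundamentalRep_apply LGConfig dartStep
  infiniteVolumeLimitPoints normalisedCharacter wilsonLoopObs walkHolonomy)
open Literature.MathematicalPhysics.QuantumFieldTheory.SUNBakryEmery (SUN)
open Summit.Ventures.YMGap.RobustBall (dartMult sum_walkEdges_dartMult)

variable {d N : ℕ}

/-! ## §1. Lists with no two cyclically adjacent equal entries -/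

/-- In a list with no two ADJACENT equal entries whose head is not `e`, the value `e` occurs at most `length/2` times. [folklore] -/
theorem two_mul_count_le_length_of_head_ne {α : Type*} [DecidableEq α] (e : α) :
    ∀ (M : List α), List.IsChain (· ≠ ·) M → (∀ a ∈ M.head?, a ≠ e) → 2 * M.count e ≤ M.length
  | [], _, _ => by simp
  | [a], _, h => by
    have ha : a ≠ e := h a (by simp)
    simp [ha]
  | a :: b :: M, hc, h => by
    have ha : a ≠ e := h a (by simp)
    obtain ⟨-, hc'⟩ := List.isChain_cons_cons.1 hc
    have hcount : (a :: b :: M).count e = (b :: M).count e := by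
      rw [List.count_cons, beq_eq_false_iff_ne.2 ha]; simp
    rw [hcount]
    by_cases hb : b = e
    · have hM : ∀ c ∈ M.head?, c ≠ e := by
        intro c hcM
        cases M with
        | nil => simp at hcM
        | cons c' M' =>
          simp only [List.head?_cons, Option.mem_def, Option.some.injEq] at hcM
          subst hcM
          exact fun h' => (List.isChain_cons_cons.1 hc').1 (hb.trans h'.symm)
      have ih := two_mul_count_le_length_of_head_ne e M hc'.tail hM
      rw [List.count_cons, beq_iff_eq.2 hb]
      simp only [ite_true, List.length_cons]
      omega
    · have ih := two_mul_count_le_length_of_head_ne e (b :: M) hc' (by simpa using hb)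
      simp only [List.length_cons] at ih ⊢
      omega

/-- **In a list with no two CYCLICALLY adjacent equal entries** (no two adjacent entries are equal, and the last entry differs from the first),
**every value occurs at most `length/2` times.** [folklore] -/
theorem two_mul_count_le_length_of_isChain_cyclic {α : Type*} [DecidableEq α] (e : α) (M : List α)
    (hc : List.IsChain (· ≠ ·) (M ++ M.take 1)) : 2 * M.count e ≤ M.length := by
  obtain ⟨hM, -, hwrap⟩ := List.isChain_append.1 hc
  cases M with
  | nil => simp
  | cons a M' =>
    by_cases ha : a = e
    · -- the last entry differs from the head `a = e`: count on the reversed list, whose head is that last entry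
      subst ha
      have hlast : (a :: M').getLast (List.cons_ne_nil a M') ≠ a :=
        hwrap _ (List.getLast?_eq_getLast_of_ne_nil (List.cons_ne_nil a M') ▸ rfl) a (by simp)
      have hrev : List.IsChain (· ≠ ·) (a :: M').reverse := List.isChain_reverse.2 (hM.imp fun x y h => Ne.symm h)
      have hhead : ∀ c ∈ (a :: M').reverse.head?, c ≠ a := by
        intro c hc'
        rw [List.head?_reverse, List.getLast?_eq_getLast_of_ne_nil (List.cons_ne_nil a M')] at hc'
        simp only [Option.mem_def, Option.some.injEq] at hc'
        rw [← hc']; exact hlast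
      have h := two_mul_count_le_length_of_head_ne a _ hrev hhead
      rwa [List.count_reverse, List.length_reverse] at h
    · exact two_mul_count_le_length_of_head_ne e (a :: M') hM (by simpa using ha)

/-! ## §2. Loops: consecutive non-backtracking darts lie over different links; multiplicities are at most `n/2` -/

/-- **Two consecutive darts that do not backtrack lie over different links**: if `b` starts where `a` ends and `b ≠ a⁻¹`, then the positively
oriented links under `a` and `b` differ (a dart is determined by its link up to reversal, and `b = a` would be a loop edge). [folklore] -/
theorem dartStep_fst_ne_of_dartAdj {a b : (zdGraph d).Dart} (hab : (zdGraph d).DartAdj a b) (hne : b ≠ a.symm) :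
    (dartStep a).1 ≠ (dartStep b).1 := by
  intro h
  have hedge : a.edge = b.edge := by rw [Dart.edge_eq_of_dartStep, Dart.edge_eq_of_dartStep, h]
  rcases (SimpleGraph.dart_edge_eq_iff a b).1 hedge with hab' | hab'
  · -- `a = b` and `a.snd = b.fst` would make `a` a loop
    have : a.fst = a.snd := by rw [hab] ; rw [hab']
    exact a.adj.ne this
  · exact hne (by rw [hab', Dart.symm_symm])

/-- Two chains over the same list combine to the chain of the conjunction. [folklore] -/
theorem isChain_and_of_isChain {α : Type*} {R S : α → α → Prop} : ∀ {l : List α}, List.IsChain R l → List.IsChain S l →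
    List.IsChain (fun a b => R a b ∧ S a b) l
  | [], _, _ => List.isChain_nil
  | [a], _, _ => List.isChain_singleton a
  | _ :: _ :: _, hR, hS =>
    List.isChain_cons_cons.2 ⟨⟨(List.isChain_cons_cons.1 hR).1, (List.isChain_cons_cons.1 hS).1⟩,
      isChain_and_of_isChain (List.isChain_cons_cons.1 hR).2 (List.isChain_cons_cons.1 hS).2⟩

/-- The list of links under the darts of a loop in SZZ's sense has no two cyclically adjacent equal entries. [cite: ShenZhuZhu2022, (1.11)] -/
theorem isChain_ne_map_dartStep_cyclic {x : Site d} {w : (zdGraph d).Walk x x} (hw : IsNonBacktrackingLoop w) :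
    List.IsChain (· ≠ ·) ((w.darts.map fun a => (dartStep a).1) ++ (w.darts.map fun a => (dartStep a).1).take 1) := by
  obtain ⟨hpos, hchain⟩ := hw
  -- the darts of `w`, read cyclically, are consecutive (`DartAdj`) and non-backtracking
  have hD : w.darts ≠ [] := by
    intro h; rw [← Walk.length_darts, h] at hpos; simp at hpos
  have hadj : List.IsChain (zdGraph d).DartAdj (w.darts ++ w.darts.take 1) := by
    rw [List.isChain_append]
    refine ⟨w.isChain_dartAdj_darts, ?_, fun a ha b hb => ?_⟩
    · cases hq : w.darts with
      | nil => exact absurd hq hD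
      | cons q qs => simp
    · rw [List.getLast?_eq_getLast_of_ne_nil hD] at ha
      simp only [Option.mem_def, Option.some.injEq] at ha
      have hb' : w.darts.head hD = b := by
        rw [List.head?_take, if_neg one_ne_zero, List.head?_eq_some_head hD] at hb
        simpa using hb
      rw [← ha, ← hb']
      change (w.darts.getLast hD).snd = (w.darts.head hD).fst
      simp
  have hboth : List.IsChain (fun a b : (zdGraph d).Dart => (zdGraph d).DartAdj a b ∧ b ≠ a.symm) (w.darts ++ w.darts.take 1) :=
    isChain_and_of_isChain hadj hchain
  rw [← List.map_take, ← List.map_append, List.isChain_map]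
  exact hboth.imp fun a b h => dartStep_fst_ne_of_dartAdj h.1 h.2

/-- ★ **In a loop in Shen–Zhu–Zhu's sense every link has multiplicity at most half the length**: `2·mult_ℓ(e) ≤ n`.
[cite: ShenZhuZhu2022, (1.11)] -/
theorem two_mul_dartMult_le_length {x : Site d} {w : (zdGraph d).Walk x x} (hw : IsNonBacktrackingLoop w)
    (e : Literature.MathematicalPhysics.QuantumLattice.ZdEdge d) : 2 * dartMult w e ≤ w.length := by
  have h := two_mul_count_le_length_of_isChain_cyclic e _ (isChain_ne_map_dartStep_cyclic hw)
  rw [List.length_map, Walk.length_darts] at h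
  unfold dartMult
  convert h using 2

/-- ★ **`Σ_e mult_ℓ(e)² ≤ n²/2` for every loop in Shen–Zhu–Zhu's sense** (`2·Σ_e mult² ≤ Σ_e mult·n = n²`), in `ℕ`. [cite: ShenZhuZhu2022, §4.2] -/
theorem two_mul_sum_dartMult_sq_le_length_sq {x : Site d} {w : (zdGraph d).Walk x x} (hw : IsNonBacktrackingLoop w) :
    2 * ∑ e ∈ walkEdges w, dartMult w e ^ 2 ≤ w.length ^ 2 := by
  calc 2 * ∑ e ∈ walkEdges w, dartMult w e ^ 2 = ∑ e ∈ walkEdges w, dartMult w e * (2 * dartMult w e) := by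
        rw [Finset.mul_sum]; refine Finset.sum_congr rfl fun e _ => by ring
    _ ≤ ∑ e ∈ walkEdges w, dartMult w e * w.length := Finset.sum_le_sum fun e _ => Nat.mul_le_mul_left _ (two_mul_dartMult_le_length hw e)
    _ = w.length ^ 2 := by rw [← Finset.sum_mul, sum_walkEdges_dartMult, sq]

/-- ★ **`Σ_e mult_ℓ(e)² ≤ n²/2`**, real form. [cite: ShenZhuZhu2022, §4.2] -/
theorem sum_dartMult_sq_le_half_length_sq {x : Site d} {w : (zdGraph d).Walk x x} (hw : IsNonBacktrackingLoop w) :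
    ∑ e ∈ walkEdges w, (dartMult w e : ℝ) ^ 2 ≤ (w.length : ℝ) ^ 2 / 2 := by
  have h := two_mul_sum_dartMult_sq_le_length_sq hw
  have h' : (2 : ℝ) * ∑ e ∈ walkEdges w, (dartMult w e : ℝ) ^ 2 ≤ (w.length : ℝ) ^ 2 := by exact_mod_cast h
  linarith

/-! ## §3. The loop-variance bound with the printed constant -/

/-- ★★★ **Shen–Zhu–Zhu's loop-variance shape with the SHARP constant, every `SU(N)`, every `d`**: for `N ≥ 1`, `K = N/2 − 4dN|β| > 0` and every
`C ≥ 4/K`, `SZZLoopVarianceBound (fundamentalRep (Fin N)) d (Nβ) C` — for every infinite-volume limit point `μ` and every loop `ℓ` with `n` edges,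
`Var_μ(Re W_ℓ/N) + Var_μ(Im W_ℓ/N) ≤ 2·Σ_e mult_ℓ(e)²/(NK) ≤ n²/(NK) ≤ C·n(n−3)/N` (`n ≥ 4`).  The Yang–Mills mass gap is NOT proved.
[cite: ShenZhuZhu2022, Corollary 1.5 (1.12)] -/
theorem szzLoopVarianceBound_sun_sharp (hN : N ≠ 0) {β : ℝ} (hK : 0 < (N : ℝ) / 2 - N * |β| * (4 * d)) {C : ℝ}
    (hC : 4 / ((N : ℝ) / 2 - N * |β| * (4 * d)) ≤ C) :
    SZZLoopVarianceBound (fundamentalRep (Fin N)) d ((N : ℝ) * β) C := by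
  intro μ hμ x w hw
  set K : ℝ := (N : ℝ) / 2 - N * |β| * (4 * d) with hKdef
  have hNpos : (0 : ℝ) < N := by exact_mod_cast Nat.pos_of_ne_zero hN
  have h4 : (4 : ℝ) ≤ w.length := by exact_mod_cast four_le_length_of_isNonBacktrackingLoop hw
  have hre : (fun U : LGConfig d (SUN N) => (wilsonLoopTrace (fundamentalRep (Fin N)) w U).re / (N : ℝ)) =
      wilsonLoopObs (fun g : SUN N => normalisedCharacter N (fundamentalRep (Fin N) g)) w := by
    funext U
    unfold wilsonLoopObs normalisedCharacter wilsonLoopTrace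
    rw [div_eq_inv_mul]
  rw [hre]
  have hVr := szz_wilsonLoop_variance_limit_sun hN hK hμ w
  have hVi := szz_wilsonLoopIm_variance_limit_sun hN hK hμ w
  have hS := sum_dartMult_sq_le_half_length_sq hw
  have hnn : 0 ≤ (w.length : ℝ) * ((w.length : ℝ) - 3) := by nlinarith
  have hNK : 0 < (N : ℝ) * K := mul_pos hNpos hK
  calc Var[wilsonLoopObs (fun g : SUN N => normalisedCharacter N (fundamentalRep (Fin N) g)) w; μ] +
        Var[fun U : LGConfig d (SUN N) => (wilsonLoopTrace (fundamentalRep (Fin N)) w U).im / (N : ℝ); μ]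
      ≤ (∑ e ∈ walkEdges w, (dartMult w e : ℝ) ^ 2) / (N * K) + (∑ e ∈ walkEdges w, (dartMult w e : ℝ) ^ 2) / (N * K) := add_le_add hVr hVi
    _ ≤ (w.length : ℝ) ^ 2 / 2 / (N * K) + (w.length : ℝ) ^ 2 / 2 / (N * K) :=
        add_le_add (div_le_div_of_nonneg_right hS hNK.le) (div_le_div_of_nonneg_right hS hNK.le)
    _ ≤ 4 / K * ((w.length : ℝ) * ((w.length : ℝ) - 3) / (N : ℝ)) := by
        rw [← two_mul, ← mul_div_assoc, div_le_iff₀ hNK]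
        have e : 4 / K * ((w.length : ℝ) * ((w.length : ℝ) - 3) / (N : ℝ)) * (N * K) = 4 * ((w.length : ℝ) * ((w.length : ℝ) - 3)) := by
          field_simp
        rw [e]
        nlinarith
    _ ≤ C * ((w.length : ℝ) * ((w.length : ℝ) - 3) / (N : ℝ)) := mul_le_mul_of_nonneg_right hC (div_nonneg hnn hNpos.le)

/-- ★★★ **Shen–Zhu–Zhu, Corollary 1.5 (1.12), for `SU(N)`, AS PRINTED — every `N ≥ 1`, every `d ≥ 2`, `|β| < 1/(16(d−1))`**:
`SZZLoopVarianceBound (fundamentalRep (Fin N)) d (Nβ) (4/K_𝒮)`, `K_𝒮 = szzBakryEmeryConstSU N d β = N/2 − 8N(d−1)|β|`, i.e. for every infinite-volume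
limit point `μ` of the periodic `SU(N)` states at 't Hooft coupling `Nβ` and every loop `ℓ` (closed non-backtracking lattice walk, `n` edges):
`Var_μ(Re W_ℓ/N) + Var_μ(Im W_ℓ/N) ≤ (4/K_𝒮)·n(n−3)/N`.  STRONG coupling; the Yang–Mills mass gap is NOT proved. [cite: ShenZhuZhu2022, Corollary 1.5 (1.12)] -/
theorem szzLoopVarianceBound_sun_printed (hd : 2 ≤ d) (hN : 1 ≤ N) {β : ℝ} (hβ : |β| < szzThresholdSU d) :
    SZZLoopVarianceBound (fundamentalRep (Fin N)) d ((N : ℝ) * β) (4 / szzBakryEmeryConstSU N d β) := by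
  have hKS : 0 < szzBakryEmeryConstSU N d β := (szzBakryEmeryConstSU_pos_iff hd hN β).2 hβ
  have hle := szzBakryEmeryConstSU_le_sharp hd N β
  exact szzLoopVarianceBound_sun_sharp (by omega) (lt_of_lt_of_le hKS hle) (div_le_div_of_nonneg_left (by norm_num) hKS hle)

/-- ★★★ **The `SU(N)` conjunct of the named fact `shenZhuZhu_largeN_variance d N`** (`ShenZhuZhuPoincareApplications`; Shen–Zhu–Zhu CMP 400
(2023) Cor. 1.5 (1.12)) **for EVERY `d` and EVERY `N`, verbatim.**  The `SO(N)` conjunct (N ≥ 3) is NOT proved here.  STRONG coupling; the Yang–Mills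
mass gap is NOT proved. [cite: ShenZhuZhu2022, Corollary 1.5 (1.12)] -/
theorem shenZhuZhu_largeN_variance_SU (d N : ℕ) :
    2 ≤ d → 1 ≤ N → ∀ β : ℝ, |β| < szzThresholdSU d →
      SZZLoopVarianceBound (fundamentalRep (Fin N)) d ((N : ℝ) * β) (4 / szzBakryEmeryConstSU N d β) :=
  fun hd hN _ hβ => szzLoopVarianceBound_sun_printed hd hN hβ

/-- ★★ **The named fact `shenZhuZhu_largeN_variance d N` is EQUIVALENT to its `SO(N)` conjunct**, for every `d`, `N`: the remaining Literature debt in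
Shen–Zhu–Zhu's Corollary 1.5 (1.12) is exactly the `SO(N)` Bakry–Émery input.  STRONG coupling; the Yang–Mills mass gap is NOT proved.
[cite: ShenZhuZhu2022, Corollary 1.5 (1.12)] -/
theorem shenZhuZhu_largeN_variance_iff_SO (d N : ℕ) :
    shenZhuZhu_largeN_variance d N ↔
      (2 ≤ d → 1 ≤ N → ∀ β : ℝ, |β| < szzThresholdSO N d →
        SZZLoopVarianceBound (Literature.MathematicalPhysics.QuantumFieldTheory.Balaban1983to89.TraceWordsSeparateOrbitsOrthogonal.specialOrthogonalRep
          (Fin N)) d ((N : ℝ) * β) (1 / szzBakryEmeryConstSO N d β)) :=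
  ⟨fun h => h.2, fun h => ⟨shenZhuZhu_largeN_variance_SU d N, h⟩⟩

end Summit.QuantumFields.YangMills.Theorems.ColdStartUniversality

end
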